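import Mathlib
import HarnessLib.Audit
import Summits.PneNP.PneNP.Theorems.PstarSliceGenericExact

/-!
# The clean two-chord theorem under EXACT-MENU genericity (ROUND-24, O1; memo g24 §34)

FRONTIER range-avoidance ladder, rung F-N3, ROUND 24 (cell `pnp-ideate`, prover-2 memo `g24/O1-NOFREEVERTEX-g24.md` §34; typed target
`PstarCoreBoundTargets.TerminalPeelable` / `TerminalFive` (p646951); restricted-model proof complexity — nothing here bears on `P` versus `NP`).

`PstarChordReadTwoClean.false_of_two_clean` (p688618) re-proved with the genericity it actually uses: for each of the two outside-gated chords,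
`SliceGenericExact` (`PstarSliceGenericExact`) for the FOUR monomial sets `∅`, `internalMenu G₁`, `internalMenu G₂`, `internalMenu (G₁ ∆ G₂)` —
bundled as `MenuGeneric I y J₀ c w₁ w₂`.  The proof is that of p688618 verbatim, with `upgrade_exact`, `local*_of_dir*_exact` and
`exists_two_slices` at the empty menu.

* `MenuGeneric`, `menuGeneric_of_sliceGeneric` (the old hypothesis implies the new one);
* `chordLocal_both_of_witness_exact`; **`false_of_two_clean_exact`**.

WHY IT MATTERS (memo §34): a certificate against `MenuGeneric` must be a reader carrying a WHOLE channel menu (`PairCore.normalForm`: `d₂.G = G ∪ F₂`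
exactly), the same three sets for every chord of the structure; the planner's census becomes joint in the menu instead of worst-case per chord.
-/

set_option linter.dupNamespace false -- `Summit.PneNP.PneNP.…`: summit = sub-problem name (D-0017 single-conjunct layout)

open Finset Literature.Computability.Complexity
open scoped symmDiff
open Summit.PneNP.PneNP.Theorems.PstarTyped (Typed)
open Summit.PneNP.PneNP.Theorems.PstarSALevel (varSet bdry BoundaryExpanding SimpleOverlap)
open Summit.PneNP.PneNP.Theorems.PstarCentreFree (vars_mem_varSet)
open Summit.PneNP.PneNP.Theorems.PstarGapOneAll (gval)
open Summit.PneNP.PneNP.Theorems.PstarGSystemFreeVar (gval_symmDiff)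
open Summit.PneNP.PneNP.Theorems.PstarChordRepair (IsChord)
open Summit.PneNP.PneNP.Theorems.PstarCoreBoundTargets (Terminal)
open Summit.PneNP.PneNP.Theorems.PstarChordReadLemma (ChordLocal SliceGeneric)
open Summit.PneNP.PneNP.Theorems.PstarChordReadGates (exists_two_slices)
open Summit.PneNP.PneNP.Theorems.PstarChordReadTwoGates (exists_xor_not_mem_of_simpleOverlap)
open Summit.PneNP.PneNP.Theorems.PstarChordReadFlip (mv)
open Summit.PneNP.PneNP.Theorems.PstarChordReadOutside (OutsideGated)
open Summit.PneNP.PneNP.Theorems.PstarChordReadRestrictVar (restrictL constL overrideL gval_restrictL)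
open Summit.PneNP.PneNP.Theorems.PstarChordReadNor (fibreList mem_fibreList overrideL_fibreList_self solves_overrideL_fibreList)
open Summit.PneNP.PneNP.Theorems.PstarChordReadFibre (outside mem_outside not_mem_outside_of_mem mem_restrictL_fst_iff not_mem_of_chordLocal
  xor_mem_iff_of_chordLocal indep_of_chordLocal symmDiff_subset_union')
open Summit.PneNP.PneNP.Theorems.PstarChordReadTwoClean (false_of_const live_of_witness)
open Summit.PneNP.PneNP.Theorems.PstarSliceGenericInternal (internalMenu internalMenu_subset)
open Summit.PneNP.PneNP.Theorems.PstarSliceGenericExact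

namespace Summit.PneNP.PneNP.Theorems.PstarTwoCleanExact

variable {n m : ℕ}

/-- **MENU GENERICITY** of the chord `c` for the reader pair `(w₁, w₂)`: exact slice genericity for the empty menu and for the internal menus of
`G₁`, `G₂`, `G₁ ∆ G₂` — the four monomial sets the clean two-chord theorem reads. -/
def MenuGeneric (I : LocalMap 4 n m) (y : Fin m → Bool) (J₀ : Finset (Fin m)) (c : Fin m) (w₁ w₂ : Finset (Fin n) × Finset (Fin m) × Bool) :
    Prop :=
  SliceGenericExact I y J₀ c ∅ ∧ SliceGenericExact I y J₀ c (internalMenu I J₀ w₁.2.1) ∧ SliceGenericExact I y J₀ c (internalMenu I J₀ w₂.2.1) ∧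
    SliceGenericExact I y J₀ c (internalMenu I J₀ (w₁.2.1 ∆ w₂.2.1))

variable {I : LocalMap 4 n m} {r : ℕ} {y : Fin m → Bool} {J₀ : Finset (Fin m)} {w₁ w₂ : Finset (Fin n) × Finset (Fin m) × Bool} {c : Fin m}

/-- The old hypothesis implies the new one. -/
theorem menuGeneric_of_sliceGeneric (h : SliceGeneric I y J₀ c (w₁.2.1 ∪ w₂.2.1)) : MenuGeneric I y J₀ c w₁ w₂ :=
  ⟨sliceGenericExact_of_sliceGeneric h (empty_subset _),
    sliceGenericExact_of_sliceGeneric h ((internalMenu_subset I J₀ _).trans subset_union_left),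
    sliceGenericExact_of_sliceGeneric h ((internalMenu_subset I J₀ _).trans subset_union_right),
    sliceGenericExact_of_sliceGeneric h ((internalMenu_subset I J₀ _).trans (symmDiff_subset_union' _ _))⟩

/-! ## Both readers are chord-local on the witness fibre -/

/-- **BOTH READERS ARE CHORD-LOCAL ON THE WITNESS FIBRE** of an outside-gated menu-generic chord (`chordLocal_both_of_witness`, re-threaded). -/
theorem chordLocal_both_of_witness_exact (hI : I.IsPure xorAndPred) (hT : Typed I) (hS : SimpleOverlap I) (hB : BoundaryExpanding r I)
    (ht : Terminal I r y J₀ w₁ w₂) (hc : c ∈ J₀) (hch : IsChord I J₀ c) (hO : OutsideGated I J₀ (w₁.2.1 ∪ w₂.2.1) c)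
    (hgen : MenuGeneric I y J₀ c w₁ w₂) (hsol : ∃ x : Fin n → Bool, ∀ j ∈ J₀, I.eval x j = y j) {w : Fin n → Bool}
    (hw : ∀ j ∈ J₀.erase c, I.eval w j = y j) (hw₁ : gval I w₁.1 w₁.2.1 w = w₁.2.2) (hw₂ : gval I w₂.1 w₂.2.1 w = w₂.2.2) :
    ChordLocal I c (restrictL I w₁.1 w₁.2.1 (fibreList (outside I J₀) w)).1 (restrictL I w₁.1 w₁.2.1 (fibreList (outside I J₀) w)).2 ∧
      ChordLocal I c (restrictL I w₂.1 w₂.2.1 (fibreList (outside I J₀) w)).1 (restrictL I w₂.1 w₂.2.1 (fibreList (outside I J₀) w)).2 := by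
  classical
  obtain ⟨-, hg₁, hg₂, hg₁₂⟩ := hgen
  have hJr : J₀.card ≤ r := ht.2.2.1.le
  have hdisj : Disjoint J₀ (w₁.2.1 ∪ w₂.2.1) := disjoint_union_right.2 ⟨ht.2.2.2.1, ht.2.2.2.2.1⟩
  have T := fun (z : Fin n → Bool) (hz : ∀ j ∈ J₀, I.eval z j = y j) (a : gval I w₁.1 w₁.2.1 z = w₁.2.2)
    (b : gval I w₂.1 w₂.2.1 z = w₂.2.2) => ht.2.2.2.2.2.2.1 ⟨z, hz, a, b⟩
  have pm₂₁ : ∀ x : Fin n → Bool, (∀ j ∈ J₀, I.eval x j = y j) → gval I w₂.1 w₂.2.1 x = w₂.2.2 → gval I w₁.1 w₁.2.1 x ≠ w₁.2.2 :=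
    fun x hx h₂ h₁ => T x hx h₁ h₂
  have pm₁₂ : ∀ x : Fin n → Bool, (∀ j ∈ J₀, I.eval x j = y j) → gval I w₁.1 w₁.2.1 x = w₁.2.2 → gval I w₂.1 w₂.2.1 x ≠ w₂.2.2 :=
    fun x hx h₁ h₂ => T x hx h₁ h₂
  have pmS₂ : ∀ x : Fin n → Bool, (∀ j ∈ J₀, I.eval x j = y j) → gval I (w₁.1 ∆ w₂.1) (w₁.2.1 ∆ w₂.2.1) x = xor w₁.2.2 w₂.2.2 →
      gval I w₂.1 w₂.2.1 x ≠ w₂.2.2 := by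
    intro x hx hS₁₂ h₂
    rw [gval_symmDiff, h₂] at hS₁₂
    exact T x hx (by revert hS₁₂; cases gval I w₁.1 w₁.2.1 x <;> cases w₁.2.2 <;> cases w₂.2.2 <;> decide) h₂
  have hwS : gval I (w₁.1 ∆ w₂.1) (w₁.2.1 ∆ w₂.2.1) w = xor w₁.2.2 w₂.2.2 := by rw [gval_symmDiff, hw₁, hw₂]
  have U₂₁ := upgrade_exact hI hT hS hB hJr hc hch hO hg₁ hdisj subset_union_right subset_union_left pm₂₁ w
  have U₁₂ := upgrade_exact hI hT hS hB hJr hc hch hO hg₂ hdisj subset_union_left subset_union_right pm₁₂ w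
  have US₂ := upgrade_exact hI hT hS hB hJr hc hch hO hg₂ hdisj (symmDiff_subset_union' _ _) subset_union_right pmS₂ w
  have K₂₁ := false_of_const hI hT hS hB hJr hdisj subset_union_left pm₂₁ hw₂ hw₁ hsol
  have K₁₂ := false_of_const hI hT hS hB hJr hdisj subset_union_right pm₁₂ hw₁ hw₂ hsol
  have KS₂ := false_of_const hI hT hS hB hJr hdisj subset_union_right pmS₂ hwS hw₂ hsol
  obtain ⟨v, v', hvv, hlive⟩ := live_of_witness hI hS ht hc hch hw hw₁ hw₂
  rcases h₁ : mv I w₁.1 w₁.2.1 v w with _ | _ <;> rcases h₂ : mv I w₂.1 w₂.2.1 v w with _ | _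
  · rw [h₁, h₂] at hlive; exact absurd hlive (by simp)
  · have L₁ := local₁_of_dir01_exact hI hS ht hc hch hO hg₁ hvv w h₁ h₂
    rcases U₁₂ L₁ with hk | L₂
    · exact (K₁₂ hk).elim
    · exact ⟨L₁, L₂⟩
  · have L₂ := local₂_of_dir10_exact hI hS ht hc hch hO hg₂ hvv w h₁ h₂
    rcases U₂₁ L₂ with hk | L₁
    · exact (K₂₁ hk).elim
    · exact ⟨L₁, L₂⟩
  · have LS := local₁₂_of_dir11_exact hI hS ht hc hch hO hg₁₂ hvv w h₁ h₂
    rcases US₂ LS with hk | L₂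
    · exact (KS₂ hk).elim
    · rcases U₂₁ L₂ with hk | L₁
      · exact (K₂₁ hk).elim
      · exact ⟨L₁, L₂⟩

/-! ## The clean two-chord theorem, exact form -/
section Main

variable {cᵢ cⱼ : Fin m}

/-- **THE CLEAN TWO-CHORD THEOREM UNDER MENU GENERICITY.**  A terminal core of a pure typed `(r,3/2)`-expanding instance with simple overlaps has no
two distinct outside-gated chords that are menu-generic (`MenuGeneric`: exact slice genericity for `∅` and the three internal channel menus). -/
theorem false_of_two_clean_exact (hI : I.IsPure xorAndPred) (hT : Typed I) (hS : SimpleOverlap I) (hB : BoundaryExpanding r I)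
    (ht : Terminal I r y J₀ w₁ w₂) (hcᵢ : cᵢ ∈ J₀) (hcⱼ : cⱼ ∈ J₀) (hne : cᵢ ≠ cⱼ) (hchᵢ : IsChord I J₀ cᵢ) (hchⱼ : IsChord I J₀ cⱼ)
    (hOᵢ : OutsideGated I J₀ (w₁.2.1 ∪ w₂.2.1) cᵢ) (hOⱼ : OutsideGated I J₀ (w₁.2.1 ∪ w₂.2.1) cⱼ)
    (hgenᵢ : MenuGeneric I y J₀ cᵢ w₁ w₂) (hgenⱼ : MenuGeneric I y J₀ cⱼ w₁ w₂) : False := by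
  classical
  have T := fun (z : Fin n → Bool) (hz : ∀ j ∈ J₀, I.eval z j = y j) (a : gval I w₁.1 w₁.2.1 z = w₁.2.2)
    (b : gval I w₂.1 w₂.2.1 z = w₂.2.2) => ht.2.2.2.2.2.2.1 ⟨z, hz, a, b⟩
  have hgen₀ : SliceGeneric I y J₀ cᵢ ∅ := sliceGeneric_empty_iff.2 hgenᵢ.1
  have hvᵢ := exists_xor_not_mem_of_simpleOverlap hI hS hne
  obtain ⟨s, hs2, hsn⟩ := exists_xor_not_mem_of_simpleOverlap hI hS hne.symm
  set Z := outside I J₀ with hZ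
  have hZout : ∀ z ∈ Z, ∀ j ∈ J₀, z ∉ varSet I j := fun z hz => (mem_outside I).1 hz
  have hsol : ∃ x : Fin n → Bool, ∀ j ∈ J₀, I.eval x j = y j := by
    obtain ⟨x, hx, -⟩ := exists_two_slices hI hcᵢ hcⱼ hne hchᵢ hchⱼ hvᵢ hgen₀ false false false false
    exact ⟨x, hx⟩
  obtain ⟨wᵢ, hwᵢ, hwᵢ₁, hwᵢ₂⟩ := ht.2.2.2.2.2.2.2 cᵢ hcᵢ
  obtain ⟨wⱼ, hwⱼ, hwⱼ₁, hwⱼ₂⟩ := ht.2.2.2.2.2.2.2 cⱼ hcⱼ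
  obtain ⟨Lᵢ₁, Lᵢ₂⟩ := chordLocal_both_of_witness_exact hI hT hS hB ht hcᵢ hchᵢ hOᵢ hgenᵢ hsol hwᵢ hwᵢ₁ hwᵢ₂
  obtain ⟨Lⱼ₁, Lⱼ₂⟩ := chordLocal_both_of_witness_exact hI hT hS hB ht hcⱼ hchⱼ hOⱼ hgenⱼ hsol hwⱼ hwⱼ₁ hwⱼ₂
  set u := I.vars cⱼ s with hu
  have huM : ∀ (G : Finset (Fin m)), ∀ g ∈ G, I.vars g 2 ≠ u ∧ I.vars g 3 ≠ u :=
    fun G g _ => ⟨(hT cⱼ g s 2 hs2 (by decide)).symm, (hT cⱼ g s 3 hs2 (by decide)).symm⟩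
  have huᵢ : ∀ t : Fin 4, u ≠ I.vars cᵢ t := fun t e => hsn (e ▸ vars_mem_varSet I cᵢ t)
  have huZ : ∀ (w : Fin n → Bool), ∀ p ∈ fibreList Z w, p.1 ≠ u := fun w p hp e =>
    not_mem_outside_of_mem I hcⱼ (hu ▸ vars_mem_varSet I cⱼ s) (e ▸ (mem_fibreList.1 hp).1)
  have hu₁ : u ∉ w₁.1 := (mem_restrictL_fst_iff I hI w₁.1 w₁.2.1 (huM _) _ (huZ wᵢ)).not.1
    (not_mem_of_chordLocal hI Lᵢ₁ (huᵢ 0) (huᵢ 1) (huᵢ 2) (huᵢ 3) (huM _))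
  have hu₂ : u ∉ w₂.1 := (mem_restrictL_fst_iff I hI w₂.1 w₂.2.1 (huM _) _ (huZ wᵢ)).not.1
    (not_mem_of_chordLocal hI Lᵢ₂ (huᵢ 0) (huᵢ 1) (huᵢ 2) (huᵢ 3) (huM _))
  have ha : ∀ {C : Finset (Fin n)} {G : Finset (Fin m)}, u ∉ C →
      ChordLocal I cⱼ (restrictL I C G (fibreList Z wⱼ)).1 (restrictL I C G (fibreList Z wⱼ)).2 →
      I.vars cⱼ 0 ∉ (restrictL I C G (fibreList Z wⱼ)).1 := by
    intro C G huC hloc h0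
    have hux : u ∉ (restrictL I C G (fibreList Z wⱼ)).1 := (mem_restrictL_fst_iff I hI C G (huM _) _ (huZ wⱼ)).not.2 huC
    have h01 := xor_mem_iff_of_chordLocal hI hT hloc
    have hs01 : s = 0 ∨ s = 1 := by
      rcases s with ⟨s, hs⟩
      rcases s with _ | _ | s
      · exact Or.inl rfl
      · exact Or.inr rfl
      · exact absurd hs2 (by simp)
    rcases hs01 with e | e
    · exact hux (by rw [hu, e]; exact h0)
    · exact hux (by rw [hu, e]; exact h01.1 h0)
  obtain ⟨ψ₁, hψ₁⟩ := indep_of_chordLocal hI hT Lⱼ₁ (ha hu₁ Lⱼ₁)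
  obtain ⟨ψ₂, hψ₂⟩ := indep_of_chordLocal hI hT Lⱼ₂ (ha hu₂ Lⱼ₂)
  obtain ⟨x, hx, -, -, exp, exq⟩ := exists_two_slices hI hcᵢ hcⱼ hne hchᵢ hchⱼ hvᵢ hgen₀ false false (wⱼ (I.vars cⱼ 2)) (wⱼ (I.vars cⱼ 3))
  have hxs := solves_overrideL_fibreList I hZout wⱼ hx
  have g₁ : gval I w₁.1 w₁.2.1 (overrideL x (fibreList Z wⱼ)) = w₁.2.2 := by
    have h := hψ₁ x
    have h' := hψ₁ wⱼ
    rw [gval_restrictL I hI hS, exp, exq] at h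
    rw [gval_restrictL I hI hS, overrideL_fibreList_self, hwⱼ₁] at h'
    rw [← h'] at h
    revert h; cases gval I w₁.1 w₁.2.1 (overrideL x (fibreList Z wⱼ)) <;> cases w₁.2.2 <;> cases constL I w₁.1 w₁.2.1 (fibreList Z wⱼ) <;> decide
  have g₂ : gval I w₂.1 w₂.2.1 (overrideL x (fibreList Z wⱼ)) = w₂.2.2 := by
    have h := hψ₂ x
    have h' := hψ₂ wⱼ
    rw [gval_restrictL I hI hS, exp, exq] at h
    rw [gval_restrictL I hI hS, overrideL_fibreList_self, hwⱼ₂] at h'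
    rw [← h'] at h
    revert h; cases gval I w₂.1 w₂.2.1 (overrideL x (fibreList Z wⱼ)) <;> cases w₂.2.2 <;> cases constL I w₂.1 w₂.2.1 (fibreList Z wⱼ) <;> decide
  exact T _ hxs g₁ g₂

end Main

end Summit.PneNP.PneNP.Theorems.PstarTwoCleanExact
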